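import Literature.MathematicalPhysics.QuantumFieldTheory.Balaban1983to89.B1Sect3Statements

/-!
# `Balaban1983to89.B1Ineq325Proof` — T. Bałaban, *(Higgs)₂,₃ quantum fields in a finite volume. I. A lower bound*,
Commun. Math. Phys. **85** (1982) 603–626 [Balaban1982Higgs1]: the two "one-line consequences" of the cumulant expansions —
**(3.25)** p. 616 from (3.24) (first step) and **(3.60)** [first display so numbered] p. 623 from (3.59) (k-th step): an
expectation of the form `exp(Σ_{n≤n̄} ⟨Vⁿ⟩^T/n! + O(s^κ)|T₁|)` is bounded BELOW by `exp(𝒫 − C·s^κ|T₁|)` for the perturbative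
expression `𝒫` (the cumulant sum, possibly with its terms of order `> n̄` in the couplings — themselves `O(s^κ)|T₁|` — removed),
PROVED over the typings of record `B1Sect3Statements.Eq324`, `B1Sect3Statements.integral356`, `B1LowerBound.Cumulant359`;
theorems only

statement-level skeleton of published theorems with citation tags; proofs where landed; nothing here is a claim about the Yang–Mills mass gap

PDF held: `paper:balaban1982-cmp85-higgs23-i` (journal page = PDF page + 602); (3.22)–(3.25) p. 616 and (3.59)–(3.60) p. 623
READ AS IMAGES on the x2 renders `run/shared/lean/pub/pub-balaban/b2b-balaban-ref1/pages/1982-cmp85-higgs23-I/…-p014-x2.png`,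
`…-p021-x2.png`.

CITATION HEADER (lean-in-tree rule).  WHAT IS REPRODUCED — SKELETON rows **B1.Eq3.25** (reader r12
`lit-balaban-r12/ROWS-B1-part2.md`: «[…] ≥ exp(𝒫′^{(1),L}(B^{(1)},ψ) − E₀ + O(ε^κ)∣T₁∣); absent · one-line consequence of
(3.24) (shape `Eq324`)») and **B1.Eq3.60a** («(3.56) ≥ exp(𝒫^{(k+1),L}(B^{(k+1)},ψ) + O(1)(L^kε)^κ∣T₁^{(k)}∣); then rescaling
gives (3.26)–(3.32) at k+1; absent · one-line consequence of (3.59)»).  Verbatim, p. 616 [PDF 14]: *"⟨χ exp(V)⟩ = exp[⟨V⟩ +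
(1/2!)⟨V²⟩^T + … + (1/n̄!)⟨V^{n̄}⟩^T + O(ε^κ)|T₁|], κ > d. (3.24) … If we denote the expression under the exponential on the
right side of this formula by 𝒫′^{(1),L}(B^{(1)}, ψ), then we can write (the integral in the square bracket […] in (3.22))
≥ exp(𝒫′^{(1),L}(B^{(1)}, ψ) − E₀ + O(ε^κ)|T₁|). (3.25) The expression 𝒫′^{(1),L} is a polynomial in ψ … we can estimate
all the terms in 𝒫′^{(1),L} of the order in coupling constants higher than n̄ by"* [O(ε^κ)|T₁|, p. 617], the bracket of
(3.22) p. 616 being *"[∫dμ_{C^{(0)}}(A′)∫dμ_{C^{(0)}(B^{(1)})}(φ′)χ(A′)χ(φ′)·exp(V^{(0)}(B^{(1)}, ψ, A′, φ′) − E₀ + O(ε^κ)|T₁|)]"*;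
p. 623 [PDF 21]: *"(3.56) = ⟨χ(A′)χ(φ′)exp(V^{(k)})⟩ = exp[Σ_{n=1}^{n̄} (1/n!)⟨(V^{(k)})ⁿ⟩^T + O(1)(L^kε)^κ|T₁^{(k)}|], κ > d.
(3.59) … Further we can estimate all the terms of the expansion of order higher than n̄ by O(1)(L^kε)^κ|T₁^{(k)}|. Let us
denote the expression we get by 𝒫^{(k+1),L}(B^{(k+1)}, ψ), so we have (3.56) ≥ exp(𝒫^{(k+1),L}(B^{(k+1)}, ψ) +
O(1)(L^kε)^κ|T₁^{(k)}|). (3.60)"*.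

READING.  `O(·)` terms are two-sided bounded quantities (as in the typings of record: `Eq324`/`Cumulant359` carry an explicit
remainder `r`, `|r| ≤ C·s^κ·vol`); an inequality `X ≥ exp(𝒫 + O(s^κ)|T₁|)` is read, as a lower bound must be, as `X ≥
exp(𝒫 − C·s^κ·vol)` for a constant `C` independent of the step.  The perturbative expression `𝒫` is the cumulant sum
`Σ_{n=1}^{n̄} ⟨Vⁿ⟩^T/n!` minus a part `H` (its terms of order `> n̄` in the couplings) which the text estimates by
`|H| ≤ C′·s^κ·vol` — an input here (`H = 0` recovers the plain reading).

WHAT THIS FILE PROVES (theorems only — no `def`, no new `Prop` fact; 0 `sorry`; standard axioms):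
* `exp_bounds_of_eq324` — `Eq324 lhs cum n̄ C s κ vol` ⇒ `exp(Σ − C s^κ vol) ≤ lhs ≤ exp(Σ + C s^κ vol)`, `Σ = Σ_{n=1}^{n̄} cum n/n!`;
* `integral356_shift` — the bracket of (3.22)/(3.55): `∫dμ∫dμ χχ·exp(V − E₀ + R) = e^{−E₀+R}·integral356 μ_A μ_φ χ χ V`;
* **`ineq325`** — (3.25): if `|R| ≤ C₁ s^κ vol` (the `O(ε^κ)|T₁|` inside the bracket), `Eq324 (integral356 …) cum n̄ C₂ s κ vol`
  ((3.24) for `⟨χe^V⟩`), and `𝒫′ = Σ − H` with `|H| ≤ C₃ s^κ vol`, then `bracket ≥ exp(𝒫′ − E₀ − (C₁ + C₂ + C₃) s^κ vol)`;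
  `eq325_remainder` — the same as an identity with an explicit two-sided remainder;
* **`ineq360a`** — (3.60) first display, one run and step with (3.59) opened at its constants and a higher-order part `H`,
  `|H| ≤ C′(L^kε)^κ|T₁^{(k)}|`: `lhs k ≥ exp((Σ − H) − (C + C′)(L^kε)^κ|T₁^{(k)}|)`; **`ineq360a_family`** — from
  `B1LowerBound.Cumulant359 fam` (plain reading `H = 0`): `∃ κ > d, C: ∀ j k, lhs k ≥ exp(Σ − C(L^kε)^κ|T₁^{(k)}|)`.
HONEST SCOPE.  Pure bookkeeping of the printed `O(·)`-notation; the cumulant expansions (3.24)/(3.59) (lemma of [2] = Benfatto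
et al., CMP 59) and the higher-order estimate are inputs, exactly as in the rows of record.  The subsequent sentence of p. 623
(*"rescaling … gives (3.26)–(3.32) with k+1"*) is not asserted here.
Unit `lit-balaban-p14` gen 3 (Phase-2 proof seat p14, literature-prover-lit-balaban-p14-g3-0), HOME
`run/shared/lean/pub/lit-balaban/` (seat log `lit-balaban-p14/STATUS.md`).
-/

namespace Literature.MathematicalPhysics.QuantumFieldTheory.Balaban1983to89.B1Ineq325Proof

open Literature.MathematicalPhysics.QuantumFieldTheory.Balaban1983to89
open B1Sect3Statements B1LowerBound MeasureTheory Finset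

/-! ## §1 Two-sided exponential bounds from a cumulant expansion with `O`-remainder -/

/-- From (3.24) in its typed form (`Eq324`: `lhs = exp(Σ_{n=1}^{n̄} cum n/n! + r)`, `|r| ≤ C s^κ vol`):
`exp(Σ − C s^κ vol) ≤ lhs ≤ exp(Σ + C s^κ vol)`. [cite: Balaban1982Higgs1, (3.24)–(3.25) p.616] -/
theorem exp_bounds_of_eq324 {lhs : ℝ} {cum : ℕ → ℝ} {nbar : ℕ} {C s κ vol : ℝ}
    (h : Eq324 lhs cum nbar C s κ vol) :
    Real.exp ((∑ n ∈ Icc 1 nbar, cum n / (n.factorial : ℝ)) - C * s ^ κ * vol) ≤ lhs ∧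
      lhs ≤ Real.exp ((∑ n ∈ Icc 1 nbar, cum n / (n.factorial : ℝ)) + C * s ^ κ * vol) := by
  obtain ⟨r, hr, rfl⟩ := h
  obtain ⟨hr1, hr2⟩ := abs_le.1 hr
  exact ⟨Real.exp_le_exp.2 (by linarith), Real.exp_le_exp.2 (by linarith)⟩

/-- A generic form of the same bookkeeping: `exp(𝒫 + H + r) ≥ exp(𝒫 − (C + C′)·t)` whenever `|r| ≤ C·t`, `|H| ≤ C′·t`
(`t` ↤ `s^κ·vol ≥ 0` implicitly through the bounds). [cite: Balaban1982Higgs1, (3.25) p.616; (3.60) p.623] -/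
theorem exp_sub_le_exp_add {P H r C C' t : ℝ} (hr : |r| ≤ C * t) (hH : |H| ≤ C' * t) :
    Real.exp (P - (C + C') * t) ≤ Real.exp (P + H + r) := by
  obtain ⟨hr1, _⟩ := abs_le.1 hr
  obtain ⟨hH1, _⟩ := abs_le.1 hH
  exact Real.exp_le_exp.2 (by linarith)

/-! ## §2 (3.25) p. 616 -/

section FirstStep

variable {ΩA Ωφ : Type*} [MeasurableSpace ΩA] [MeasurableSpace Ωφ]

/-- The bracket of (3.22) (and the last factor of (3.55)): the number `−E₀ + R` (`R` ↤ `O(ε^κ)|T₁|`) comes out of the double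
Gaussian integral — `∫dμ(A′)∫dμ(φ′) χ(A′)χ(φ′)exp(V − E₀ + R) = e^{−E₀+R}·∫dμ∫dμ χχ exp V`, the last integral being (3.56)
`B1Sect3Statements.integral356`. [cite: Balaban1982Higgs1, (3.22) p.616] -/
theorem integral356_shift (μA : Measure ΩA) (μφ : Measure Ωφ) (χA : ΩA → ℝ) (χφ : Ωφ → ℝ) (V : ΩA → Ωφ → ℝ)
    (E₀ R : ℝ) :
    ∫ a, ∫ f, χA a * χφ f * Real.exp (V a f - E₀ + R) ∂μφ ∂μA
      = Real.exp (-E₀ + R) * integral356 μA μφ χA χφ V := by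
  unfold integral356
  have hin : ∀ a, ∫ f, χA a * χφ f * Real.exp (V a f - E₀ + R) ∂μφ
      = (∫ f, χA a * χφ f * Real.exp (V a f) ∂μφ) * Real.exp (-E₀ + R) := by
    intro a
    rw [← integral_mul_const]
    congr 1
    funext f
    rw [show V a f - E₀ + R = V a f + (-E₀ + R) by ring, Real.exp_add]
    ring
  simp_rw [hin]
  rw [integral_mul_const, mul_comm]

/-- **(3.25) p. 616**: with the expectation `⟨χ exp V⟩ = integral356 μ_{C^{(0)}} μ_{C^{(0)}(B^{(1)})} χ χ V^{(0)}` (normalised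
Gaussian measures) expanded as in (3.24) (`Eq324 … cum n̄ C₂ s κ vol`, `s = ε`, `vol = |T₁|`), the `O(ε^κ)|T₁|` of the
bracket of (3.22) a number `R` with `|R| ≤ C₁ s^κ vol`, and the perturbative expression `𝒫′^{(1),L}(B^{(1)},ψ) = Σ_{n=1}^{n̄}
⟨Vⁿ⟩^T/n! − H` (`H` = its part of order `> n̄` in the couplings, `|H| ≤ C₃ s^κ vol`, p. 616–617; `H = 0` allowed):
*"(the integral in the square bracket […] in (3.22)) ≥ exp(𝒫′^{(1),L}(B^{(1)}, ψ) − E₀ + O(ε^κ)|T₁|)"*, the `O` read as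
`−(C₁ + C₂ + C₃)ε^κ|T₁|`. [cite: Balaban1982Higgs1, (3.25) p.616] -/
theorem ineq325 (μA : Measure ΩA) (μφ : Measure Ωφ) (χA : ΩA → ℝ) (χφ : Ωφ → ℝ) (V : ΩA → Ωφ → ℝ)
    {E₀ R H C₁ C₂ C₃ s κ vol : ℝ} {cum : ℕ → ℝ} {nbar : ℕ}
    (hR : |R| ≤ C₁ * (s ^ κ * vol)) (hH : |H| ≤ C₃ * (s ^ κ * vol))
    (h324 : Eq324 (integral356 μA μφ χA χφ V) cum nbar C₂ s κ vol) :
    Real.exp (((∑ n ∈ Icc 1 nbar, cum n / (n.factorial : ℝ)) - H) - E₀ - (C₁ + C₂ + C₃) * (s ^ κ * vol))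
      ≤ ∫ a, ∫ f, χA a * χφ f * Real.exp (V a f - E₀ + R) ∂μφ ∂μA := by
  obtain ⟨r, hr, h⟩ := h324
  rw [integral356_shift, h, ← Real.exp_add]
  obtain ⟨hr1, _⟩ := abs_le.1 hr
  obtain ⟨hR1, _⟩ := abs_le.1 hR
  obtain ⟨hH1, _⟩ := abs_le.1 hH
  exact Real.exp_le_exp.2 (by nlinarith)

/-- (3.25) as an identity with a two-sided remainder (the content of the `O`-notation): the bracket EQUALS
`exp(𝒫′ − E₀ + ρ)` with `|ρ| ≤ (C₁ + C₂ + C₃)ε^κ|T₁|`. [cite: Balaban1982Higgs1, (3.25) p.616] -/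
theorem eq325_remainder (μA : Measure ΩA) (μφ : Measure Ωφ) (χA : ΩA → ℝ) (χφ : Ωφ → ℝ) (V : ΩA → Ωφ → ℝ)
    {E₀ R H C₁ C₂ C₃ s κ vol : ℝ} {cum : ℕ → ℝ} {nbar : ℕ}
    (hR : |R| ≤ C₁ * (s ^ κ * vol)) (hH : |H| ≤ C₃ * (s ^ κ * vol))
    (h324 : Eq324 (integral356 μA μφ χA χφ V) cum nbar C₂ s κ vol) :
    ∃ ρ : ℝ, |ρ| ≤ (C₁ + C₂ + C₃) * (s ^ κ * vol) ∧
      ∫ a, ∫ f, χA a * χφ f * Real.exp (V a f - E₀ + R) ∂μφ ∂μA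
        = Real.exp (((∑ n ∈ Icc 1 nbar, cum n / (n.factorial : ℝ)) - H) - E₀ + ρ) := by
  obtain ⟨r, hr, h⟩ := h324
  refine ⟨R + r + H, ?_, ?_⟩
  · calc |R + r + H| ≤ |R| + |r| + |H| := abs_add_three _ _ _
      _ ≤ C₁ * (s ^ κ * vol) + C₂ * s ^ κ * vol + C₃ * (s ^ κ * vol) := add_le_add_three hR hr hH
      _ = (C₁ + C₂ + C₃) * (s ^ κ * vol) := by ring
  · rw [integral356_shift, h, ← Real.exp_add]
    congr 1
    ring

end FirstStep

/-! ## §3 (3.60) first display, p. 623 -/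

/-- **(3.60) p. 623** [the first of the two displays numbered (3.60), r12 note T3], one run `j`, one step `k`, with the
expansion (3.59) OPENED at its constants: `lhs k = ⟨χ(A′)χ(φ′)exp(V^{(k)})⟩ = exp(Σ_{n=1}^{n̄}⟨(V^{(k)})ⁿ⟩^T/n! + R)`, `|R| ≤
C(L^kε)^κ|T₁^{(k)}|`, and the printed estimate of the terms of order `> n̄` in the couplings, `|H| ≤ C′(L^kε)^κ|T₁^{(k)}|`
(`H = 0` allowed): *"(3.56) ≥ exp(𝒫^{(k+1),L}(B^{(k+1)}, ψ) + O(1)(L^kε)^κ|T₁^{(k)}|)"* with `𝒫^{(k+1),L} = Σ − H` and the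
`O(1)`-term read as `−(C + C′)(L^kε)^κ|T₁^{(k)}|`. [cite: Balaban1982Higgs1, (3.60) p.623] -/
theorem ineq360a (S : C359Setting) (k : ℕ) {κ C C' R H : ℝ}
    (hR : |R| ≤ C * S.ell k ^ κ * S.volK k)
    (hlhs : S.lhs k = Real.exp ((∑ n ∈ Icc 1 S.nbar, S.trunc k n / (n.factorial : ℝ)) + R))
    (hH : |H| ≤ C' * S.ell k ^ κ * S.volK k) :
    Real.exp (((∑ n ∈ Icc 1 S.nbar, S.trunc k n / (n.factorial : ℝ)) - H) - (C + C') * (S.ell k ^ κ * S.volK k))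
      ≤ S.lhs k := by
  rw [hlhs]
  obtain ⟨hR1, _⟩ := abs_le.1 hR
  obtain ⟨hH1, _⟩ := abs_le.1 hH
  exact Real.exp_le_exp.2 (by nlinarith)

/-- **(3.60) along a whole family of runs** from the typing of record `B1LowerBound.Cumulant359 fam` (one `κ > d`, one `C`
for all runs and steps), plain reading `𝒫^{(k+1),L} = Σ_{n=1}^{n̄}⟨(V^{(k)})ⁿ⟩^T/n!`: `∃ κ > d, C: ∀ j k, (3.56) ≥ exp(𝒫 −
C(L^kε)^κ|T₁^{(k)}|)` — the constants uniform in the run and the step, as the induction (3.26) at `k + 1` requires.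
[cite: Balaban1982Higgs1, (3.60) p.623] -/
theorem ineq360a_family {J : Type} (fam : J → C359Setting) (h359 : Cumulant359 fam) :
    ∃ κ C : ℝ, (∀ j, ((fam j).d : ℝ) < κ) ∧ ∀ (j : J) (k : ℕ),
      Real.exp ((∑ n ∈ Icc 1 (fam j).nbar, (fam j).trunc k n / (n.factorial : ℝ))
          - C * ((fam j).ell k ^ κ * (fam j).volK k)) ≤ (fam j).lhs k := by
  obtain ⟨κ, C, hκ, h⟩ := h359
  refine ⟨κ, C, hκ, fun j k => ?_⟩
  obtain ⟨R, hR, hlhs⟩ := h j k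
  have h0 : |(0 : ℝ)| ≤ 0 * (fam j).ell k ^ κ * (fam j).volK k := by simp
  simpa using ineq360a (fam j) k hR hlhs h0

end Literature.MathematicalPhysics.QuantumFieldTheory.Balaban1983to89.B1Ineq325Proof
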